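import Summits.Ventures.HodgeRepro.Tier3PinningGlue
import Summits.Ventures.HodgeRepro.Tier3ValueTransfer
import Summits.Ventures.HodgeRepro.Tier3RootsOfUnityEval
import Summits.Ventures.HodgeRepro.Tier3PadicComplexInt

/-!
# Tier 3, T3.2 — (R2) ∧ (R1): the pinning chain with the BRANCH ELEMENT as the named input
(seat t3-p3, gen 13)

Blind re-derivation cell `pub-hodge-repro`, Tier-3 seat `t3-p3` (route/TIER3.md §3 row R-B, §6).  The named input
R-B is stated in TWO forms on the page: «ONE ν₀ ∈ Ξ per line with `L(½, χ_j′ν₀) ≠ 0` (⟺ the degree-one Katz branch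
element on `Γ⁻ ≅ ℤ_ℓ` is ≠ 0)» (TIER3.md §3 R-B; §6: «one non-vanishing twist per line ⟺ the degree-one Katz branch
element ≠ 0»), and the form in which the printed theorems enter — Hsieh 2014 Thm 1 / Burungale–Hida 2017 Thm B give
the VANISHING OF THE μ-INVARIANT of the anticyclotomic measure, i.e. `G_j ≢ 0 (mod ϖ)`, hence `G_j ≠ 0`, not a value.
Every face theorem of the kernel chain so far takes `h0` in the VALUE form only (`Tier3PinningGlue`,
`Tier3RootsOfUnityEval`, `Tier3PadicCharacters`, `Tier3PadicComplexInt`, `Tier3ValueTransfer`); that the branch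
element is non-zero was derived INSIDE `PowerSeries.finite_vanishing_of_interpolation` (t3-p4 `Tier3Weierstrass`)
and never exposed.  This file puts the equivalence and the branch-element forms on the kernel:

* `branch_ne_zero_of_exists_ne_zero` / `exists_ne_zero_of_branch_ne_zero` / `exists_ne_zero_iff_branch_ne_zero` —
  under the interpolation formula `L ν = u ν · G(ζ ν − 1)` (non-zero `u ν`, `ζ` injective, `Ξ` infinite):
  ONE non-vanishing value ⟺ `G ≠ 0` — the parenthetical of R-B;
* `branch_ne_zero_of_map_residue_ne_zero` — `μ(G) = 0` (`G.map (residue A) ≠ 0`) ⇒ `G ≠ 0`;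
* `finite_vanishing_of_branch_ne_zero` / `cofinite_good_of_branch_ne_zero` — the one-line cofinite statements
  with `G ≠ 0` in place of the value;
* `ncard_vanishing_le_natDegree_weierstrassDistinguished` — under `μ(G) = 0` the number of twists `ν` with
  `L ν = 0` is at most `λ(G)`, the degree of the Weierstrass polynomial (t3-p4's uniform bound read on `Ξ`);
* `four_line_pinning_of_branch_ne_zero` / `four_line_pinning_of_mu_zero` — the face with `G j ≠ 0`, resp.
  `(G j).map (residue A) ≠ 0`, per line;
* `four_line_pinning_of_mu_zero_transfer` / `four_line_pinning_padicComplex_of_mu_zero` — the same with the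
  `L`-values in the field (`Tier3ValueTransfer`), and on `𝓞_ℂ_[p] ⊂ ℂ_[p]` with `p`-power roots of unity.

HONESTY.  Every analytic / arithmetic input is a HYPOTHESIS here — the interpolation formula (`hL` / `hm`), the
relation to the `L`-values with its non-vanishing constants (`hrel`, `hc`), the sign cofiniteness (`hε`), and the
named input in either form (`h0`, `hG`, `hμ`); that `μ⁻ = 0` holds for the route's characters is the PRINTED content of
Hsieh / Burungale–Hida under THEIR hypotheses (TIER3.md §3 R-B (α′), NOT closed in print for the face's lines) and is
not asserted anywhere in this file.  Nothing about Hecke characters, measures or `L`-functions is proved.  Nothing here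
says anything about the status of the Hodge conjecture for CM abelian varieties, which is NOT proved.
-/

set_option autoImplicit false

namespace Summit.Ventures.HodgeRepro.T3.R2Pinning

open PowerSeries

section Branch

variable {A : Type*} [CommRing A] [IsDomain A] [IsDiscreteValuationRing A]
  [IsAdicComplete (IsLocalRing.maximalIdeal A) A] [UniformSpace A] [IsUniformAddGroup A]
  [IsTopologicalRing A]
variable {B : Type*} [CommRing B] [IsDomain B] [UniformSpace B] [IsUniformAddGroup B] [T2Space B]
  [CompleteSpace B] [IsTopologicalRing B] [IsLinearTopology B B] [Algebra A B] [ContinuousSMul A B]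
variable {Ξ : Type*}

omit [IsAdicComplete (IsLocalRing.maximalIdeal A) A] [UniformSpace A] [IsUniformAddGroup A]
  [IsTopologicalRing A] in
/-- **μ = 0 ⇒ the branch element is non-zero**: a power series with non-zero image in the residue field is non-zero. -/
theorem branch_ne_zero_of_map_residue_ne_zero (G : PowerSeries A)
    (hμ : G.map (IsLocalRing.residue A) ≠ 0) : G ≠ 0 := by
  rintro rfl
  exact hμ (map_zero _)

omit [IsDomain A] [IsDiscreteValuationRing A] [IsAdicComplete (IsLocalRing.maximalIdeal A) A] [IsDomain B] in
/-- **One value ⇒ branch element**: under the interpolation formula, ONE non-vanishing value forces `G ≠ 0`. -/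
theorem branch_ne_zero_of_exists_ne_zero (ζ : Ξ → B) (hev : ∀ ν, HasEval (ζ ν - 1)) (G : PowerSeries A)
    (L u : Ξ → B) (hL : ∀ ν, L ν = u ν * aeval (hev ν) G) (h0 : ∃ ν₀, L ν₀ ≠ 0) : G ≠ 0 := by
  obtain ⟨ν₀, hν₀⟩ := h0
  rintro rfl
  exact hν₀ (by rw [hL, map_zero, mul_zero])

/-- **Branch element ⇒ finitely many vanishing twists**: if `G ≠ 0`, then `L ν = 0` for finitely many `ν` (the
Weierstrass item of t3-p4 read along the injective `ν ↦ ζ ν`). -/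
theorem finite_vanishing_of_branch_ne_zero (hinj : Function.Injective (algebraMap A B))
    (ζ : Ξ → B) (hζ : Function.Injective ζ) (hev : ∀ ν, HasEval (ζ ν - 1)) (G : PowerSeries A)
    (L u : Ξ → B) (hu : ∀ ν, u ν ≠ 0) (hL : ∀ ν, L ν = u ν * aeval (hev ν) G) (hG : G ≠ 0) :
    {ν | L ν = 0}.Finite := by
  have hfin := finite_rootsOfUnity_zeros_of_ne_zero (B := B) hinj hG
  refine (hfin.preimage hζ.injOn).subset ?_
  intro ν hν
  refine ⟨hev ν, ?_⟩
  have : u ν * aeval (hev ν) G = 0 := by rw [← hL]; exact hν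
  exact (mul_eq_zero.mp this).resolve_left (hu ν)

/-- **Branch element ⇒ one value** (`Ξ` infinite): if `G ≠ 0`, some twist has `L ν₀ ≠ 0`. -/
theorem exists_ne_zero_of_branch_ne_zero [Infinite Ξ] (hinj : Function.Injective (algebraMap A B))
    (ζ : Ξ → B) (hζ : Function.Injective ζ) (hev : ∀ ν, HasEval (ζ ν - 1)) (G : PowerSeries A)
    (L u : Ξ → B) (hu : ∀ ν, u ν ≠ 0) (hL : ∀ ν, L ν = u ν * aeval (hev ν) G) (hG : G ≠ 0) :
    ∃ ν₀, L ν₀ ≠ 0 := by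
  obtain ⟨ν₀, hν₀⟩ :=
    (finite_vanishing_of_branch_ne_zero hinj ζ hζ hev G L u hu hL hG).infinite_compl.nonempty
  exact ⟨ν₀, hν₀⟩

/-- **The parenthetical of R-B on the kernel**: under the interpolation formula on an infinite twist set,
«ONE non-vanishing value» ⟺ «the branch element is non-zero». -/
theorem exists_ne_zero_iff_branch_ne_zero [Infinite Ξ] (hinj : Function.Injective (algebraMap A B))
    (ζ : Ξ → B) (hζ : Function.Injective ζ) (hev : ∀ ν, HasEval (ζ ν - 1)) (G : PowerSeries A)
    (L u : Ξ → B) (hu : ∀ ν, u ν ≠ 0) (hL : ∀ ν, L ν = u ν * aeval (hev ν) G) :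
    (∃ ν₀, L ν₀ ≠ 0) ↔ G ≠ 0 :=
  ⟨branch_ne_zero_of_exists_ne_zero ζ hev G L u hL,
    exists_ne_zero_of_branch_ne_zero hinj ζ hζ hev G L u hu hL⟩

/-- **The uniform bound on the twists** (μ = 0 form): the number of `ν` with `L ν = 0` is at most the degree
`λ(G)` of the Weierstrass polynomial of `G` — the same bound for every value ring `B`. -/
theorem ncard_vanishing_le_natDegree_weierstrassDistinguished
    (ζ : Ξ → B) (hζ : Function.Injective ζ) (hev : ∀ ν, HasEval (ζ ν - 1)) (G : PowerSeries A)
    (hμ : G.map (IsLocalRing.residue A) ≠ 0) (L u : Ξ → B) (hu : ∀ ν, u ν ≠ 0)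
    (hL : ∀ ν, L ν = u ν * aeval (hev ν) G) :
    {ν | L ν = 0}.ncard ≤ (G.weierstrassDistinguished hμ).natDegree := by
  have hZ : {x : B | ∃ hx : HasEval x, aeval hx G = 0}.Finite :=
    finite_zeros_of_map_residue_ne_zero (B := B) G hμ
  refine le_trans (Set.ncard_le_ncard_of_injOn (fun ν => ζ ν - 1) ?_ ?_ hZ)
    (ncard_zeros_le_natDegree_weierstrassDistinguished (B := B) G hμ)
  · intro ν hν
    refine ⟨hev ν, ?_⟩
    have : u ν * aeval (hev ν) G = 0 := by rw [← hL]; exact hν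
    exact (mul_eq_zero.mp this).resolve_left (hu ν)
  · exact (sub_left_injective.comp hζ).injOn

/-- **One line, branch-element form**: interpolation data, `G ≠ 0` and finitely many bad signs ⇒ the good set
`{ν | L ν ≠ 0 ∧ ε ν = 1}` is cofinite. -/
theorem cofinite_good_of_branch_ne_zero (hinj : Function.Injective (algebraMap A B))
    (ζ : Ξ → B) (hζ : Function.Injective ζ) (hev : ∀ ν, HasEval (ζ ν - 1)) (G : PowerSeries A)
    (L u : Ξ → B) (hu : ∀ ν, u ν ≠ 0) (hL : ∀ ν, L ν = u ν * aeval (hev ν) G) (hG : G ≠ 0)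
    (ε : Ξ → ℤˣ) (hε : {ν | ε ν ≠ 1}.Finite) :
    {ν | L ν ≠ 0 ∧ ε ν = 1}ᶜ.Finite := by
  have hfin := finite_vanishing_of_branch_ne_zero hinj ζ hζ hev G L u hu hL hG
  refine (hfin.union hε).subset ?_
  intro ν hν
  simp only [Set.mem_compl_iff, Set.mem_setOf_eq, not_and_or, not_not] at hν
  simp only [Set.mem_union, Set.mem_setOf_eq]
  exact hν

/-- **The face, branch-element form**: four lines over the infinite commutative group `Ξ`, interpolation data per
line, `G j ≠ 0` per line (R-B in its «branch element ≠ 0» form), finitely many bad signs per line ⇒ infinitely many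
common good `ν`, and N2 for the constant twist vector. -/
theorem four_line_pinning_of_branch_ne_zero [Infinite Ξ] [CommGroup Ξ]
    (hinj : Function.Injective (algebraMap A B))
    (ζ : Ξ → B) (hζ : Function.Injective ζ) (hev : ∀ ν, HasEval (ζ ν - 1)) (G : Fin 4 → PowerSeries A)
    (L u : Fin 4 → Ξ → B) (hu : ∀ j ν, u j ν ≠ 0) (hL : ∀ j ν, L j ν = u j ν * aeval (hev ν) (G j))
    (hG : ∀ j, G j ≠ 0) (ε : Fin 4 → Ξ → ℤˣ) (hε : ∀ j, {ν | ε j ν ≠ 1}.Finite) :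
    {ν : Ξ | ∀ j, L j ν ≠ 0 ∧ ε j ν = 1}.Infinite ∧
      ∀ ν ∈ {ν : Ξ | ∀ j, L j ν ≠ 0 ∧ ε j ν = 1}, ∀ η : Fin 4 → Ξ, (∀ j, η j = ν) →
        η 0 * η 1 = η 2 * η 3 :=
  four_line_pinning_of_interpolation (B := B) hinj ζ hζ hev G L u hu hL
    (fun j => exists_ne_zero_of_branch_ne_zero hinj ζ hζ hev (G j) (L j) (u j) (hu j) (hL j) (hG j)) ε hε

/-- **The face, μ = 0 form**: as `four_line_pinning_of_branch_ne_zero` with the hypothesis in the form the printed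
theorems deliver — `(G j).map (residue A) ≠ 0` («μ⁻_j = 0») per line. -/
theorem four_line_pinning_of_mu_zero [Infinite Ξ] [CommGroup Ξ]
    (hinj : Function.Injective (algebraMap A B))
    (ζ : Ξ → B) (hζ : Function.Injective ζ) (hev : ∀ ν, HasEval (ζ ν - 1)) (G : Fin 4 → PowerSeries A)
    (L u : Fin 4 → Ξ → B) (hu : ∀ j ν, u j ν ≠ 0) (hL : ∀ j ν, L j ν = u j ν * aeval (hev ν) (G j))
    (hμ : ∀ j, (G j).map (IsLocalRing.residue A) ≠ 0) (ε : Fin 4 → Ξ → ℤˣ)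
    (hε : ∀ j, {ν | ε j ν ≠ 1}.Finite) :
    {ν : Ξ | ∀ j, L j ν ≠ 0 ∧ ε j ν = 1}.Infinite ∧
      ∀ ν ∈ {ν : Ξ | ∀ j, L j ν ≠ 0 ∧ ε j ν = 1}, ∀ η : Fin 4 → Ξ, (∀ j, η j = ν) →
        η 0 * η 1 = η 2 * η 3 :=
  four_line_pinning_of_branch_ne_zero hinj ζ hζ hev G L u hu hL
    (fun j => branch_ne_zero_of_map_residue_ne_zero (G j) (hμ j)) ε hε

end Branch

section Transfer

variable {A : Type*} [CommRing A] [IsDomain A] [IsDiscreteValuationRing A]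
  [IsAdicComplete (IsLocalRing.maximalIdeal A) A] [UniformSpace A] [IsUniformAddGroup A]
  [IsTopologicalRing A]
variable {B : Type*} [CommRing B] [IsDomain B] [UniformSpace B] [IsUniformAddGroup B] [T2Space B]
  [CompleteSpace B] [IsTopologicalRing B] [IsLinearTopology B B] [Algebra A B] [ContinuousSMul A B]
variable {F : Type*} [CommRing F] [IsDomain F]
variable {Ξ : Type*}

/-- **The face, μ = 0 form, values in the field**: the measure values `m j ν ∈ B` interpolate the branch elements
`G j` with `(G j).map (residue A) ≠ 0`; the `L`-values `v j ν ∈ F` satisfy `ι (m j ν) = c j ν · v j ν` with non-zero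
constants (`Tier3ValueTransfer`); finitely many bad signs per line ⇒ infinitely many `ν` make all four `L`-values
non-zero with all four signs `+1`, and N2 holds for the constant vector. -/
theorem four_line_pinning_of_mu_zero_transfer [Infinite Ξ] [CommGroup Ξ]
    (hinj : Function.Injective (algebraMap A B))
    (ζ : Ξ → B) (hζ : Function.Injective ζ) (hev : ∀ ν, HasEval (ζ ν - 1)) (G : Fin 4 → PowerSeries A)
    (m u : Fin 4 → Ξ → B) (hu : ∀ j ν, u j ν ≠ 0) (hm : ∀ j ν, m j ν = u j ν * aeval (hev ν) (G j))
    (hμ : ∀ j, (G j).map (IsLocalRing.residue A) ≠ 0)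
    (ι : B →+* F) (hι : Function.Injective ι) (c v : Fin 4 → Ξ → F) (hc : ∀ j ν, c j ν ≠ 0)
    (hrel : ∀ j ν, ι (m j ν) = c j ν * v j ν)
    (ε : Fin 4 → Ξ → ℤˣ) (hε : ∀ j, {ν | ε j ν ≠ 1}.Finite) :
    {ν : Ξ | ∀ j, v j ν ≠ 0 ∧ ε j ν = 1}.Infinite ∧
      ∀ ν ∈ {ν : Ξ | ∀ j, v j ν ≠ 0 ∧ ε j ν = 1}, ∀ η : Fin 4 → Ξ, (∀ j, η j = ν) →
        η 0 * η 1 = η 2 * η 3 :=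
  four_line_pinning_of_interpolation_transfer (B := B) hinj ζ hζ hev G m u hu hm ι hι c v hc hrel
    (fun j => (ValueTransfer.exists_ne_zero_iff ι hι (m j) (c j) (v j) (hc j) (hrel j)).mpr
      (exists_ne_zero_of_branch_ne_zero hinj ζ hζ hev (G j) (m j) (u j) (hu j) (hm j)
        (branch_ne_zero_of_map_residue_ne_zero (G j) (hμ j)))) ε hε

end Transfer

section PadicInstance

variable {p : ℕ} [Fact p.Prime]
variable {A : Type*} [CommRing A] [IsDomain A] [IsDiscreteValuationRing A]
  [IsAdicComplete (IsLocalRing.maximalIdeal A) A] [UniformSpace A] [IsUniformAddGroup A]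
  [IsTopologicalRing A] [Algebra A 𝓞_ℂ_[p]] [ContinuousSMul A 𝓞_ℂ_[p]]
variable {Ξ : Type*}

/-- **The face on `𝓞_ℂ_[p] ⊂ ℂ_[p]`, μ = 0 form, finite-order twists**: the measure values `m j ν ∈ 𝓞_ℂ_[p]`
interpolate at the `p`-power roots of unity `ζ ν − 1`; `(G j).map (residue A) ≠ 0` per line; the `L`-values
`v j ν ∈ ℂ_[p]` satisfy `(m j ν : ℂ_[p]) = c j ν * v j ν` with non-zero constants; finitely many bad signs per line. -/
theorem four_line_pinning_padicComplex_of_mu_zero [Infinite Ξ] [CommGroup Ξ]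
    (hinj : Function.Injective (algebraMap A 𝓞_ℂ_[p]))
    (ζ : Ξ → 𝓞_ℂ_[p]) (hζ : Function.Injective ζ) (n : Ξ → ℕ) (hroot : ∀ ν, ζ ν ^ p ^ n ν = 1)
    (G : Fin 4 → PowerSeries A) (m u : Fin 4 → Ξ → 𝓞_ℂ_[p]) (hu : ∀ j ν, u j ν ≠ 0)
    (hm : ∀ j ν, m j ν = u j ν * aeval (hasEval_sub_one_of_pow_prime_pow_eq_one (Fact.out : p.Prime)
      (isTopologicallyNilpotent_natCast_prime p) (hroot ν)) (G j))
    (hμ : ∀ j, (G j).map (IsLocalRing.residue A) ≠ 0)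
    (c v : Fin 4 → Ξ → ℂ_[p]) (hc : ∀ j ν, c j ν ≠ 0) (hrel : ∀ j ν, ((m j ν : 𝓞_ℂ_[p]) : ℂ_[p]) = c j ν * v j ν)
    (ε : Fin 4 → Ξ → ℤˣ) (hε : ∀ j, {ν | ε j ν ≠ 1}.Finite) :
    {ν : Ξ | ∀ j, v j ν ≠ 0 ∧ ε j ν = 1}.Infinite ∧
      ∀ ν ∈ {ν : Ξ | ∀ j, v j ν ≠ 0 ∧ ε j ν = 1}, ∀ η : Fin 4 → Ξ, (∀ j, η j = ν) →
        η 0 * η 1 = η 2 * η 3 :=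
  four_line_pinning_of_mu_zero_transfer (B := 𝓞_ℂ_[p]) hinj ζ hζ
    (fun ν => hasEval_sub_one_of_pow_prime_pow_eq_one (Fact.out : p.Prime)
      (isTopologicallyNilpotent_natCast_prime p) (hroot ν)) G m u hu hm hμ
    (𝓞_ℂ_[p]).subtype (ValuationSubring.subtype_injective _) c v hc hrel ε hε

end PadicInstance

end Summit.Ventures.HodgeRepro.T3.R2Pinning

namespace Summit.Ventures.HodgeRepro.T3.R2Pinning

open PowerSeries

section MuFinite

/-!
### v2 (t3-p3 g13, APPEND): the «μ < ∞» form of the named input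

The endgame census words R-B as «μ⁻ < ∞ on the κ ≠ 0 lines or one non-vanishing value».  For `G ∈ A⟦X⟧` over the
DVR `A` with uniformiser `ϖ`, «μ(G) < ∞» is the statement `G = ϖ^μ • g'` with `g' ≢ 0 (mod ϖ)` for some `μ : ℕ` — the
decomposition t3-p4's `PowerSeries.exists_smul_eq_of_ne_zero` produces from `G ≠ 0` (no definition of the μ-invariant
is introduced; the decomposition IS the statement, and `μ = 0` is the form of `four_line_pinning_of_mu_zero`).

* `exists_smul_map_residue_ne_zero_iff_ne_zero` — «μ(G) < ∞» ⟺ `G ≠ 0`;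
* `four_line_pinning_of_mu_finite` / `four_line_pinning_padicComplex_of_mu_finite` — the face with «μ⁻_j < ∞» per
  line, and its instance on `𝓞_ℂ_[p] ⊂ ℂ_[p]` with the `L`-values in the field.
-/

variable {A : Type*} [CommRing A] [IsDomain A] [IsDiscreteValuationRing A]
  [IsAdicComplete (IsLocalRing.maximalIdeal A) A] [UniformSpace A] [IsUniformAddGroup A]
  [IsTopologicalRing A]
variable {B : Type*} [CommRing B] [IsDomain B] [UniformSpace B] [IsUniformAddGroup B] [T2Space B]
  [CompleteSpace B] [IsTopologicalRing B] [IsLinearTopology B B] [Algebra A B] [ContinuousSMul A B]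
variable {Ξ : Type*}

omit [IsAdicComplete (IsLocalRing.maximalIdeal A) A] [UniformSpace A] [IsUniformAddGroup A]
  [IsTopologicalRing A] in
/-- **«μ(G) < ∞» ⟺ `G ≠ 0`**: a power series over a DVR is `ϖ^μ • g'` with `g'` of non-zero residue image iff it is
non-zero (`←` is t3-p4's `exists_smul_eq_of_ne_zero`; `→`: `ϖ^μ • g' = 0` forces `g' = 0` coefficientwise). -/
theorem exists_smul_map_residue_ne_zero_iff_ne_zero {ϖ : A} (hϖ : Irreducible ϖ) (G : PowerSeries A) :
    (∃ (μ : ℕ) (g' : PowerSeries A), G = ϖ ^ μ • g' ∧ g'.map (IsLocalRing.residue A) ≠ 0) ↔ G ≠ 0 := by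
  constructor
  · rintro ⟨μ, g', rfl, hg'⟩ h0
    apply hg'
    have hg0 : g' = 0 := by
      ext n
      have h := congrArg (coeff n) h0
      rw [coeff_smul, map_zero, smul_eq_mul] at h
      simpa using (mul_eq_zero.mp h).resolve_left (pow_ne_zero μ hϖ.ne_zero)
    rw [hg0, map_zero]
  · exact fun hG => exists_smul_eq_of_ne_zero hϖ hG

/-- **The face, μ < ∞ form**: as `four_line_pinning_of_branch_ne_zero` with «μ⁻_j < ∞» per line — `G j = ϖ^μ • g'`
with `g' ≢ 0 (mod ϖ)`. -/
theorem four_line_pinning_of_mu_finite [Infinite Ξ] [CommGroup Ξ] {ϖ : A} (hϖ : Irreducible ϖ)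
    (hinj : Function.Injective (algebraMap A B))
    (ζ : Ξ → B) (hζ : Function.Injective ζ) (hev : ∀ ν, HasEval (ζ ν - 1)) (G : Fin 4 → PowerSeries A)
    (L u : Fin 4 → Ξ → B) (hu : ∀ j ν, u j ν ≠ 0) (hL : ∀ j ν, L j ν = u j ν * aeval (hev ν) (G j))
    (hμ : ∀ j, ∃ (μ : ℕ) (g' : PowerSeries A), G j = ϖ ^ μ • g' ∧ g'.map (IsLocalRing.residue A) ≠ 0)
    (ε : Fin 4 → Ξ → ℤˣ) (hε : ∀ j, {ν | ε j ν ≠ 1}.Finite) :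
    {ν : Ξ | ∀ j, L j ν ≠ 0 ∧ ε j ν = 1}.Infinite ∧
      ∀ ν ∈ {ν : Ξ | ∀ j, L j ν ≠ 0 ∧ ε j ν = 1}, ∀ η : Fin 4 → Ξ, (∀ j, η j = ν) →
        η 0 * η 1 = η 2 * η 3 :=
  four_line_pinning_of_branch_ne_zero hinj ζ hζ hev G L u hu hL
    (fun j => (exists_smul_map_residue_ne_zero_iff_ne_zero hϖ (G j)).mp (hμ j)) ε hε

end MuFinite

section PadicInstanceMuFinite

variable {p : ℕ} [Fact p.Prime]
variable {A : Type*} [CommRing A] [IsDomain A] [IsDiscreteValuationRing A]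
  [IsAdicComplete (IsLocalRing.maximalIdeal A) A] [UniformSpace A] [IsUniformAddGroup A]
  [IsTopologicalRing A] [Algebra A 𝓞_ℂ_[p]] [ContinuousSMul A 𝓞_ℂ_[p]]
variable {Ξ : Type*}

/-- **The face on `𝓞_ℂ_[p] ⊂ ℂ_[p]`, μ < ∞ form, finite-order twists, values in the field**: as
`four_line_pinning_padicComplex_of_mu_zero` with «μ⁻_j < ∞» (`G j = ϖ^μ • g'`, `g' ≢ 0 (mod ϖ)`) per line. -/
theorem four_line_pinning_padicComplex_of_mu_finite [Infinite Ξ] [CommGroup Ξ] {ϖ : A} (hϖ : Irreducible ϖ)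
    (hinj : Function.Injective (algebraMap A 𝓞_ℂ_[p]))
    (ζ : Ξ → 𝓞_ℂ_[p]) (hζ : Function.Injective ζ) (n : Ξ → ℕ) (hroot : ∀ ν, ζ ν ^ p ^ n ν = 1)
    (G : Fin 4 → PowerSeries A) (m u : Fin 4 → Ξ → 𝓞_ℂ_[p]) (hu : ∀ j ν, u j ν ≠ 0)
    (hm : ∀ j ν, m j ν = u j ν * aeval (hasEval_sub_one_of_pow_prime_pow_eq_one (Fact.out : p.Prime)
      (isTopologicallyNilpotent_natCast_prime p) (hroot ν)) (G j))
    (hμ : ∀ j, ∃ (μ : ℕ) (g' : PowerSeries A), G j = ϖ ^ μ • g' ∧ g'.map (IsLocalRing.residue A) ≠ 0)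
    (c v : Fin 4 → Ξ → ℂ_[p]) (hc : ∀ j ν, c j ν ≠ 0) (hrel : ∀ j ν, ((m j ν : 𝓞_ℂ_[p]) : ℂ_[p]) = c j ν * v j ν)
    (ε : Fin 4 → Ξ → ℤˣ) (hε : ∀ j, {ν | ε j ν ≠ 1}.Finite) :
    {ν : Ξ | ∀ j, v j ν ≠ 0 ∧ ε j ν = 1}.Infinite ∧
      ∀ ν ∈ {ν : Ξ | ∀ j, v j ν ≠ 0 ∧ ε j ν = 1}, ∀ η : Fin 4 → Ξ, (∀ j, η j = ν) →
        η 0 * η 1 = η 2 * η 3 :=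
  four_line_pinning_of_interpolation_transfer (B := 𝓞_ℂ_[p]) hinj ζ hζ
    (fun ν => hasEval_sub_one_of_pow_prime_pow_eq_one (Fact.out : p.Prime)
      (isTopologicallyNilpotent_natCast_prime p) (hroot ν)) G m u hu hm
    (𝓞_ℂ_[p]).subtype (ValuationSubring.subtype_injective _) c v hc hrel
    (fun j => (ValueTransfer.exists_ne_zero_iff (𝓞_ℂ_[p]).subtype (ValuationSubring.subtype_injective _)
      (m j) (c j) (v j) (hc j) (hrel j)).mpr
      (exists_ne_zero_of_branch_ne_zero hinj ζ hζ
        (fun ν => hasEval_sub_one_of_pow_prime_pow_eq_one (Fact.out : p.Prime)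
          (isTopologicallyNilpotent_natCast_prime p) (hroot ν)) (G j) (m j) (u j) (hu j) (hm j)
        ((exists_smul_map_residue_ne_zero_iff_ne_zero hϖ (G j)).mp (hμ j)))) ε hε

end PadicInstanceMuFinite

end Summit.Ventures.HodgeRepro.T3.R2Pinning
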